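import Summits.ResolutionOfSingularities.ResolutionOfSingularities.Theorems.RadicialJungCleanModelsLocalMonomializationAlongCoarsening
import Literature.AlgebraicGeometry.Resolution.RankOneReductionProofs
import HarnessLib

/-!
# The blowing up along `(a, Y)` for PRESCRIBED generators `Y` of the centre of `ν₁` and PRESCRIBED `a ∉ 𝔭` (Novacoski–Spivakovsky Lemma 2.19 + §3.1 count), with its structure recorded

Route `RadicialJung`, crux `CleanModels` (stmt-ResolutionOfSingularities-15917), registered skeleton `Cruxes/CleanModels/Lines/Sketch.lean`
rev 35 (sha16 de44649d8f729c3b), stub 7 `stub_cleanModelsDimGEFour`.  Explicit-unit seat `decomp-res-hand-2` g4 (structural hand); memo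
`Cruxes/CleanModels/Lines/Sketch-memo-hand2-g4-stubs-5-7.md` §5 item (3b).  OURS; structural bookkeeping, counted 0; nothing here proves resolution
of singularities in characteristic `p`.

The tree's ✓ `novacoskiSpivakovsky2014_step` (`Literature/…/RankOneReductionProofs.lean`: for `ν = ν₁ ∘ ν₂`, `O ≤ O₁`, an affine model `A ⊆ O`
with `A_𝔭` regular and `A_𝔮 / 𝔭` regular, ONE blowing up `A' = A[y/a]` along `(a, y₁, …, y_r)` gives `A'_{𝔮'}` regular — NS §3.1 pp. 14–15 with
Lemmas 2.18/2.19) records only the regularity.  The REPAIRED route to the weak-embedded rank-one reduction (memo §2b: do §3.1 FIRST, so that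
`𝔭' = (y')` is part of a regular system of parameters) needs the STRUCTURE of this step as well.  This file re-runs the proof VERBATIM (credit to
the original file and its authors) and exports, besides regularity:
(α) `locAtCentre A' O₁ = locAtCentre A O₁` (Lemma 2.19 (ii): the local ring at the centre of `ν₁` is unchanged);
(β) the centre `𝔭'` of `ν₁` on `A'` is GENERATED (as an ideal of `A'`) by a finite set `Y'` of at most `dim A'_{𝔭'}` elements, each of
    `ν₁`-value `< 1` (their `P' = J' = (y/a)`), so `𝔭'` is generated by part of a regular system of parameters;
(γ) residues are unchanged: every element of `A'` has the `κ(O₁)`-residue of an element of `A` (Lemma 2.19 (i)).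
[cite: NovacoskiSpivakovsky2014, §3.1, Lemma 2.18, Lemma 2.19]
-/

noncomputable section

set_option linter.dupNamespace false -- mandated namespace of this single-conjunct summit

open IsLocalRing
open Literature.AlgebraicGeometry.Resolution

namespace Summit.ResolutionOfSingularities.ResolutionOfSingularities.Theorems.RadicialJung.CleanModels

variable {k K : Type} [Field k] [Field K] [Algebra k K]

/-- Membership in the centre: `a ∈ m_O ∩ A ↔ ν(a) < 1` (copy of the private lemma of `RankOneReductionProofs.lean`). [folklore] -/
private theorem mem_centre_iff_lt_one' (O : ValuationSubring K) (A : Subalgebra k K)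
    (h : A.toSubring ≤ O.toSubring) (a : A.toSubring) :
    a ∈ ((maximalIdeal O).comap (Subring.inclusion h)) ↔ O.valuation a < 1 := by
  rw [Ideal.mem_comap, ValuationSubring.valuation_lt_one_iff]
  rfl

/-- **The blowing up along `(a, Y)` with `Y` a PRESCRIBED finite generating set of the centre `𝔭` of `ν₁` and `a ∉ 𝔭` PRESCRIBED**
(Novacoski–Spivakovsky 2014, Lemma 2.19 + the count of §3.1; the tree's ✓ `novacoskiSpivakovsky2014_step` chooses `Y` and `a` itself): if
`#Y ≤ dim A_𝔭` (regularity of `A_𝔭` is then automatic and not assumed), `𝔭 = (Y)` and `A_𝔮/𝔭` is regular, then `A' = A[y/a : y ∈ Y]` is regular at the centre of `ν`, with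
`locAtCentre A' O₁ = locAtCentre A O₁`, the new centre of `ν₁` generated by `Y' = {y/a}` (`#Y' ≤ dim`, `ν₁ < 1`), and residues unchanged.
Proof verbatim from ✓ `novacoskiSpivakovsky2014_step` (Steps 3–4), credit to the original.  Used with `a := ∏ x_l^{m_l}` in the absorption step
of the repaired weak-embedded rank-one reduction (memo §2b / §5 (3e)). [cite: NovacoskiSpivakovsky2014, Lemma 2.19 and §3.1] -/
theorem blowupAlong_generators_of_centre (O O₁ : ValuationSubring K) (hO : O ≤ O₁)
    (A : Subalgebra k K) (hA : A.toSubring ≤ O.toSubring) (hAfg : A.FG)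
    (hfrac : IsFractionRing A K)
    (hregQ : IsRegularLocalRing
      (Localization.AtPrime ((maximalIdeal O).comap (Subring.inclusion hA)) ⧸
        ((maximalIdeal O₁).comap (Subring.inclusion (hA.trans hO))).map
          (algebraMap A.toSubring
            (Localization.AtPrime ((maximalIdeal O).comap (Subring.inclusion hA))))))
    (Y : Finset A.toSubring)
    (hIY : ((maximalIdeal O₁).comap (Subring.inclusion (hA.trans hO))) = Ideal.span (Y : Set A.toSubring))
    (hYcard' : (Y.card : WithBot ℕ∞) ≤ ringKrullDim
      (Localization.AtPrime ((maximalIdeal O₁).comap (Subring.inclusion (hA.trans hO)))))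
    (a : A.toSubring) (haP : a ∈ ((maximalIdeal O₁).comap (Subring.inclusion (hA.trans hO))).primeCompl) :
    ∃ (A' : Subalgebra k K) (hA' : A'.toSubring ≤ O.toSubring), A ≤ A' ∧ A'.FG ∧
      A' = A ⊔ Algebra.adjoin k ((fun y : A.toSubring => (y : K) / (a : K)) '' (Y : Set A.toSubring)) ∧
      IsRegularLocalRing
        (Localization.AtPrime ((maximalIdeal O).comap (Subring.inclusion hA'))) ∧
      locAtCentre A'.toSubring O₁ = locAtCentre A.toSubring O₁ ∧
      (∃ Y' : Finset A'.toSubring,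
        ((maximalIdeal O₁).comap (Subring.inclusion (hA'.trans hO))) = Ideal.span (Y' : Set A'.toSubring) ∧
        (Y'.card : WithBot ℕ∞) ≤ ringKrullDim
          (Localization.AtPrime ((maximalIdeal O₁).comap (Subring.inclusion (hA'.trans hO)))) ∧
        (∀ y' ∈ Y', O₁.valuation ((y' : A'.toSubring) : K) < 1) ∧
        (∀ y' ∈ Y', ∃ y ∈ Y, ((y' : A'.toSubring) : K) = (y : K) / (a : K)) ∧
        (∀ y ∈ Y, ∃ y' ∈ Y', ((y' : A'.toSubring) : K) = (y : K) / (a : K))) ∧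
      (∀ x : A'.toSubring, ∃ c : A.toSubring,
        ((residue O₁).comp (Subring.inclusion (hA'.trans hO))) x
          = ((residue O₁).comp (Subring.inclusion (hA.trans hO))) c) := by
  classical
  haveI : IsFractionRing A.toSubring K := hfrac
  haveI hnoeth : IsNoetherianRing A.toSubring := isNoetherianRing_of_fg hAfg
  have hAO₁ : A.toSubring ≤ O₁.toSubring := hA.trans hO
  set P := ((maximalIdeal O₁).comap (Subring.inclusion hAO₁)) with hPdef
  set Q := ((maximalIdeal O).comap (Subring.inclusion hA)) with hQdef
  have hPQ : P ≤ Q := centre_mono O O₁ hO A hA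
  -- Steps 1–2 of the original are INPUTS here: `P = (Y)`, `#Y ≤ dim A_P`, `a ∉ P`.
  let AP := Localization.AtPrime P
  set IY : Ideal A.toSubring := Ideal.span (Y : Set A.toSubring) with hIYdef
  have hYP : ∀ y ∈ Y, y ∈ P := fun y hy => hIY ▸ Ideal.subset_span hy
  have hamul : ∀ z ∈ P, a * z ∈ IY := fun z hz => by rw [← hIY]; exact Ideal.mul_mem_left _ _ hz
  have ha1 : O₁.valuation (a : K) = 1 := (mem_primeCompl_centre_iff O₁ A hAO₁ a).mp haP
  have ha0 : (a : K) ≠ 0 := by intro h; rw [h, map_zero] at ha1; exact zero_ne_one ha1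
  -- Step 3: the blowing up `A' = A[y/a : y ∈ Y]` along `(a, Y)`.
  let w₀ : A.toSubring → K := fun y => (y : K) / (a : K)
  have hw₀val : ∀ y ∈ Y, O₁.valuation (w₀ y) < 1 := by
    intro y hy
    have := (mem_centre_iff_lt_one' O₁ A hAO₁ y).mp (hYP y hy)
    simp only [w₀, map_div₀, ha1, div_one]
    exact this
  have hw₀O₁ : ∀ y ∈ Y, w₀ y ∈ O₁ := fun y hy =>
    (O₁.valuation_le_one_iff _).mp (hw₀val y hy).le
  have hw₀O : ∀ y ∈ Y, w₀ y ∈ O := by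
    intro y hy
    apply mem_of_mem_maximalIdeal_of_le O O₁ hO ⟨w₀ y, hw₀O₁ y hy⟩
    rw [ValuationSubring.valuation_lt_one_iff]
    exact hw₀val y hy
  let W : Finset K := Y.image w₀
  let A' : Subalgebra k K := A ⊔ Algebra.adjoin k (W : Set K)
  have hk : ∀ c : k, algebraMap k K c ∈ O := fun c => hA (A.algebraMap_mem c)
  have hA'O : A'.toSubring ≤ O.toSubring := by
    have : A' ≤ ({ O.toSubring with algebraMap_mem' := hk } : Subalgebra k K) := by
      refine sup_le (fun x hx => hA hx) (Algebra.adjoin_le ?_)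
      intro x hx
      rw [Finset.coe_image] at hx
      obtain ⟨y, hy, rfl⟩ := hx
      exact hw₀O y hy
    exact fun x hx => this hx
  have hAA' : A ≤ A' := le_sup_left
  have hA'fg : A'.FG := hAfg.sup ⟨_, rfl⟩
  have hA'O₁ : A'.toSubring ≤ O₁.toSubring := hA'O.trans hO
  haveI hfrac' : IsFractionRing A'.toSubring K := isFractionRing_subalgebra_of_le A A' hAA'
  haveI hnoeth' : IsNoetherianRing A'.toSubring := isNoetherianRing_of_fg hA'fg
  have hwA' : ∀ y ∈ Y, w₀ y ∈ A' := by
    intro y hy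
    apply (le_sup_right : Algebra.adjoin k (W : Set K) ≤ A')
    apply Algebra.subset_adjoin
    rw [Finset.coe_image]
    exact ⟨y, hy, rfl⟩
  set P' := ((maximalIdeal O₁).comap (Subring.inclusion hA'O₁)) with hP'def
  set Q' := ((maximalIdeal O).comap (Subring.inclusion hA'O)) with hQ'def
  have hP'Q' : P' ≤ Q' := centre_mono O O₁ hO A' hA'O
  let incl : A.toSubring →+* A'.toSubring := Subring.inclusion fun x hx => hAA' hx
  have hinclP : ∀ c : A.toSubring, incl c ∈ P' ↔ c ∈ P := fun c => Iff.rfl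
  have hinclQ : ∀ c : A.toSubring, incl c ∈ Q' ↔ c ∈ Q := fun c => Iff.rfl
  -- the ideal `J' = (y/a : y ∈ Y) A'`
  let w : Y → A'.toSubring := fun y => ⟨w₀ y, hwA' y y.2⟩
  set J' : Ideal A'.toSubring := Ideal.span (Set.range w) with hJ'def
  have hJ'P' : J' ≤ P' := by
    rw [hJ'def, Ideal.span_le]
    rintro _ ⟨y, rfl⟩
    rw [SetLike.mem_coe, mem_centre_iff_lt_one']
    exact hw₀val y y.2
  -- `P ⊆ J'`
  have hincl_y : ∀ y : Y, incl y = incl a * w y := by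
    intro y
    apply Subtype.ext
    change ((y : A.toSubring) : K) = (a : K) * (((y : A.toSubring) : K) / (a : K))
    field_simp
  have hPJ' : ∀ z ∈ P, incl z ∈ J' := by
    intro z hz
    have h1 : incl (a * z) ∈ Ideal.span {incl a} * J' := by
      have : IY.map incl ≤ Ideal.span {incl a} * J' := by
        rw [hIYdef, Ideal.map_span, Ideal.span_le]
        rintro _ ⟨y, hy, rfl⟩
        rw [SetLike.mem_coe, show incl y = incl a * w ⟨y, hy⟩ from hincl_y ⟨y, hy⟩]
        exact Ideal.mul_mem_mul (Ideal.mem_span_singleton_self _)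
          (Ideal.subset_span ⟨⟨y, hy⟩, rfl⟩)
      exact this (Ideal.mem_map_of_mem _ (hamul z hz))
    rw [Ideal.mem_span_singleton_mul] at h1
    obtain ⟨b, hb, hab⟩ := h1
    rw [map_mul] at hab
    have ha0' : incl a ≠ 0 := by
      intro h; apply ha0
      exact congrArg Subtype.val h
    rw [← mul_left_cancel₀ ha0' hab]
    exact hb
  -- `A' = A + J'`
  have hdecomp : ∀ x : A'.toSubring, ∃ c : A.toSubring, x - incl c ∈ J' := by
    let T : Subalgebra k K :=
      { carrier := {x | ∃ X : A'.toSubring, (X : K) = x ∧ ∃ c : A.toSubring, X - incl c ∈ J'}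
        mul_mem' := by
          rintro _ _ ⟨X, rfl, c, hc⟩ ⟨X', rfl, c', hc'⟩
          refine ⟨X * X', rfl, c * c', ?_⟩
          have : X * X' - incl (c * c') = (X - incl c) * X' + incl c * (X' - incl c') := by
            rw [map_mul]; ring
          rw [this]
          exact J'.add_mem (J'.mul_mem_right _ hc) (J'.mul_mem_left _ hc')
        one_mem' := ⟨1, rfl, 1, by rw [map_one, sub_self]; exact J'.zero_mem⟩
        add_mem' := by
          rintro _ _ ⟨X, rfl, c, hc⟩ ⟨X', rfl, c', hc'⟩
          refine ⟨X + X', rfl, c + c', ?_⟩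
          have : X + X' - incl (c + c') = (X - incl c) + (X' - incl c') := by
            rw [map_add]; ring
          rw [this]
          exact J'.add_mem hc hc'
        zero_mem' := ⟨0, rfl, 0, by rw [map_zero, sub_self]; exact J'.zero_mem⟩
        algebraMap_mem' := fun c₀ => by
          refine ⟨⟨algebraMap k K c₀, A'.algebraMap_mem c₀⟩, rfl,
            ⟨algebraMap k K c₀, A.algebraMap_mem c₀⟩, ?_⟩
          have e : incl ⟨algebraMap k K c₀, A.algebraMap_mem c₀⟩ =
              (⟨algebraMap k K c₀, A'.algebraMap_mem c₀⟩ : A'.toSubring) := Subtype.ext rfl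
          rw [e, sub_self]; exact J'.zero_mem }
    have hA'T : A' ≤ T := by
      refine sup_le (fun x hx => ?_) (Algebra.adjoin_le fun x hx => ?_)
      · refine ⟨⟨x, hAA' hx⟩, rfl, ⟨x, hx⟩, ?_⟩
        have e : incl ⟨x, hx⟩ = (⟨x, hAA' hx⟩ : A'.toSubring) := Subtype.ext rfl
        rw [e, sub_self]; exact J'.zero_mem
      · rw [Finset.coe_image] at hx
        obtain ⟨y, hy, rfl⟩ := hx
        exact ⟨w ⟨y, hy⟩, rfl, 0, by
          rw [map_zero, sub_zero]; exact Ideal.subset_span ⟨⟨y, hy⟩, rfl⟩⟩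
    intro x
    obtain ⟨X, hX, c, hc⟩ := hA'T x.2
    have : X = x := Subtype.ext hX
    exact ⟨c, this ▸ hc⟩
  -- residues of `A'` are residues of `A` (Lemma 2.19 (i))
  have hres : ∀ x : A'.toSubring, ∃ c : A.toSubring,
      ((residue O₁).comp (Subring.inclusion hA'O₁)) x
          = ((residue O₁).comp (Subring.inclusion hAO₁)) c := by
    intro x
    obtain ⟨c, hc⟩ := hdecomp x
    refine ⟨c, ?_⟩
    have h0 : ((residue O₁).comp (Subring.inclusion hA'O₁)) (x - incl c) = 0 :=
      (residue_inclusion_eq_zero_iff O₁ A' hA'O₁ _).mpr (hJ'P' hc)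
    rw [map_sub, sub_eq_zero] at h0
    exact h0
  -- `P' = J'`
  have hP'J' : P' = J' := by
    refine le_antisymm (fun z hz => ?_) hJ'P'
    obtain ⟨c, hc⟩ := hdecomp z
    have hc' : incl c ∈ P' := by
      have := P'.sub_mem hz (hJ'P' hc)
      rwa [sub_sub_cancel] at this
    have := J'.add_mem hc (hPJ' c ((hinclP c).mp hc'))
    rwa [sub_add_cancel] at this
  -- `A'_{P'} = A_P` inside `K` (Lemma 2.19 (ii))
  have heq1 : ((Localization.subalgebra.ofField K
      ((maximalIdeal O₁).comap (Subring.inclusion hA'O₁)).primeCompl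
      (Ideal.primeCompl_le_nonZeroDivisors _)) : Set K)
      = (Localization.subalgebra.ofField K
      ((maximalIdeal O₁).comap (Subring.inclusion hAO₁)).primeCompl
      (Ideal.primeCompl_le_nonZeroDivisors _)) := by
    have h1 : (A' : Set K) ⊆ (Localization.subalgebra.ofField K
        ((maximalIdeal O₁).comap (Subring.inclusion hAO₁)).primeCompl
        (Ideal.primeCompl_le_nonZeroDivisors _)) := by
      refine fun x hx => (sup_le (fun x hx => le_centreLocalization O₁ A hAO₁ hx)
        (Algebra.adjoin_le ?_) : A' ≤ { ((Localization.subalgebra.ofField K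
            ((maximalIdeal O₁).comap (Subring.inclusion hAO₁)).primeCompl
            (Ideal.primeCompl_le_nonZeroDivisors _))).toSubring with
          algebraMap_mem' := fun c =>
            le_centreLocalization O₁ A hAO₁ (A.algebraMap_mem c) }) hx
      intro x hx
      rw [Finset.coe_image] at hx
      obtain ⟨y, hy, rfl⟩ := hx
      change w₀ y ∈ (Localization.subalgebra.ofField K
          ((maximalIdeal O₁).comap (Subring.inclusion hAO₁)).primeCompl
          (Ideal.primeCompl_le_nonZeroDivisors _))
      rw [mem_centreLocalization_iff]
      exact ⟨y, y.2, a, a.2, ha1, div_eq_mul_inv _ _⟩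
    have h2 : (A : Set K) ⊆ (Localization.subalgebra.ofField K
        ((maximalIdeal O₁).comap (Subring.inclusion hA'O₁)).primeCompl
        (Ideal.primeCompl_le_nonZeroDivisors _)) :=
      fun x hx => le_centreLocalization O₁ A' hA'O₁ (hAA' hx)
    exact le_antisymm (centreLocalization_le O₁ A' A hA'O₁ hAO₁ h1)
      (centreLocalization_le O₁ A A' hAO₁ hA'O₁ h2)
  have hdimP : ringKrullDim (Localization.AtPrime P') = ringKrullDim AP := by
    let e₁ := (IsLocalization.algEquiv P'.primeCompl (Localization.AtPrime P')
      ((Localization.subalgebra.ofField K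
          ((maximalIdeal O₁).comap (Subring.inclusion hA'O₁)).primeCompl
          (Ideal.primeCompl_le_nonZeroDivisors _)))).toRingEquiv
    have heq' : ((Localization.subalgebra.ofField K
        ((maximalIdeal O₁).comap (Subring.inclusion hA'O₁)).primeCompl
        (Ideal.primeCompl_le_nonZeroDivisors _))).toSubring =
        ((Localization.subalgebra.ofField K
            ((maximalIdeal O₁).comap (Subring.inclusion hAO₁)).primeCompl
            (Ideal.primeCompl_le_nonZeroDivisors _))).toSubring := SetLike.coe_injective heq1
    let e₂ : ((Localization.subalgebra.ofField K
        ((maximalIdeal O₁).comap (Subring.inclusion hA'O₁)).primeCompl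
        (Ideal.primeCompl_le_nonZeroDivisors _)))
        ≃+* ((Localization.subalgebra.ofField K
        ((maximalIdeal O₁).comap (Subring.inclusion hAO₁)).primeCompl
        (Ideal.primeCompl_le_nonZeroDivisors _))) :=
      RingEquiv.subringCongr heq'
    let e₃ := (IsLocalization.algEquiv P.primeCompl AP
        ((Localization.subalgebra.ofField K
        ((maximalIdeal O₁).comap (Subring.inclusion hAO₁)).primeCompl
        (Ideal.primeCompl_le_nonZeroDivisors _)))).toRingEquiv
    exact ringKrullDim_eq_of_ringEquiv (e₁.trans (e₂.trans e₃.symm))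
  -- `A'_{Q'} / P' ≅ A_Q / P` is regular
  have hregSQ : IsRegularLocalRing (Localization.AtPrime Q' ⧸
      P'.map (algebraMap A'.toSubring (Localization.AtPrime Q'))) := by
    obtain ⟨θ, hθ⟩ := exists_centreResidueLift O O₁ hO A hA
    obtain ⟨θ', hθ'⟩ := exists_centreResidueLift O O₁ hO A' hA'O
    have hrange := range_centreResidueLift_eq O O₁ hO A hA θ hθ A' hA'O hAA' θ' hθ' hres
    obtain ⟨e₁⟩ := nonempty_quotCentre_ringEquiv_range O O₁ hO A hA θ hθ
    obtain ⟨e₂⟩ := nonempty_quotCentre_ringEquiv_range O O₁ hO A' hA'O θ' hθ'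
    have e : (Localization.AtPrime Q ⧸ P.map (algebraMap A.toSubring (Localization.AtPrime Q))) ≃+*
        (Localization.AtPrime Q' ⧸ P'.map (algebraMap A'.toSubring (Localization.AtPrime Q'))) :=
      e₁.trans ((RingEquiv.subringCongr hrange.symm).trans e₂.symm)
    haveI := hregQ
    exact IsRegularLocalRing.of_ringEquiv
      (R := Localization.AtPrime Q ⧸ P.map (algebraMap A.toSubring (Localization.AtPrime Q))) e
  -- Step 4: `P'` is generated by `#Y ≤ dim A_P = dim A'_{P'}` elements; count dimensions.
  let Y' : Finset A'.toSubring := (Finset.univ : Finset Y).image w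
  have hY' : P' = Ideal.span (Y' : Set A'.toSubring) := by
    rw [hP'J', hJ'def]
    congr 1
    simp only [Y', Finset.coe_image, Finset.coe_univ, Set.image_univ]
  have hY'card : (Y'.card : WithBot ℕ∞) ≤ ringKrullDim (Localization.AtPrime P') := by
    rw [hdimP]
    have : Y'.card ≤ Y.card :=
      Finset.card_image_le.trans (by rw [Finset.card_univ, Fintype.card_coe])
    exact le_trans (by exact_mod_cast this) hYcard'
  -- (α) the local ring at the centre of `ν₁` is unchanged, in `locAtCentre` currency
  have hα : locAtCentre A'.toSubring O₁ = locAtCentre A.toSubring O₁ := by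
    refine locAtCentre_eq_of_mutual_le O₁ A'.toSubring A.toSubring ?_ (fun x hx => le_locAtCentre _ _ (hAA' hx))
    let L : Subalgebra k K :=
      ({ locAtCentre A.toSubring O₁ with
          algebraMap_mem' := fun c => le_locAtCentre A.toSubring O₁ (A.algebraMap_mem c) } : Subalgebra k K)
    have : A' ≤ L := by
      refine sup_le (fun x hx => le_locAtCentre A.toSubring O₁ hx) (Algebra.adjoin_le ?_)
      intro x hx
      rw [Finset.coe_image] at hx
      obtain ⟨y, -, rfl⟩ := hx
      exact ⟨y, y.2, a, a.2, ha1, rfl⟩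
    exact fun x hx => this hx
  have hY'val : ∀ y' ∈ Y', O₁.valuation ((y' : A'.toSubring) : K) < 1 := by
    intro y' hy'
    obtain ⟨y, -, rfl⟩ := Finset.mem_image.mp hy'
    exact hw₀val y y.2
  have hY'Y : ∀ y' ∈ Y', ∃ y ∈ Y, ((y' : A'.toSubring) : K) = (y : K) / (a : K) := by
    intro y' hy'
    obtain ⟨y, -, rfl⟩ := Finset.mem_image.mp hy'
    exact ⟨y, y.2, rfl⟩
  have hYY' : ∀ y ∈ Y, ∃ y' ∈ Y', ((y' : A'.toSubring) : K) = (y : K) / (a : K) := by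
    intro y hy
    exact ⟨w ⟨y, hy⟩, Finset.mem_image.mpr ⟨⟨y, hy⟩, Finset.mem_univ _, rfl⟩, rfl⟩
  have hA'eq : A' = A ⊔ Algebra.adjoin k ((fun y : A.toSubring => (y : K) / (a : K)) '' (Y : Set A.toSubring)) := by
    change A ⊔ Algebra.adjoin k (W : Set K) = _
    rw [Finset.coe_image]
  exact ⟨A', hA'O, hAA', hA'fg, hA'eq,
    isRegularLocalRing_localization_of_quotient P' Q' hP'Q' Y' hY' hY'card hregSQ, hα,
    ⟨Y', hY', hY'card, hY'val, hY'Y, hYY'⟩, hres⟩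

end Summit.ResolutionOfSingularities.ResolutionOfSingularities.Theorems.RadicialJung.CleanModels

end
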